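import Literature.Topology.FourManifolds.HomotopySpheresBP
import Literature.Topology.FourManifolds.InteriorManifold
import Literature.Topology.FourManifolds.ConnectedSumData
import Literature.Topology.FourManifolds.SmoothEmbeddingComp
import Literature.Topology.FourManifolds.SmoothEmbeddingCriteria
import Literature.Topology.FourManifolds.GluingConstructionBoundary
import Literature.Topology.FourManifolds.ClosedBallSmoothMaps
import Literature.Topology.FourManifolds.NeckCapping
import Mathlib.Topology.Homeomorph.Lemmas
import HarnessLib

/-!
# Removing an open ball from the interior of a bounding manifold (Kervaire–Milnor, proof of Lemma 2.3)

Topic `Literature/Topology/FourManifolds`. Kervaire–Milnor, *Groups of homotopy spheres I*,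
Ann. of Math. 77 (1963), proof of Lemma 2.3 (p. 506): "if `M = bW'` …, then removing the interior
of an imbedded disk we obtain a … manifold `W` with `bW = M + (-Sⁿ)`" (likewise Milnor, *Lectures
on the h-cobordism theorem* (1965), §1). This file carries out this construction for the tree's
`Literature.Topology.FourManifolds.NullCobordism` / `Literature.Topology.FourManifolds.Cobordism` and proves the named fact
`Literature.Topology.FourManifolds.NullCobordism.exists_cobordism_sphere_compl_ball` of `HomotopySpheresInverse.lean` (the
smooth half of Kervaire–Milnor's Lemma 2.3 in the tree's decomposition), see
`NullCobordism.exists_cobordism_sphere_compl_ball_holds`.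

## Construction

Let `W'` be a compact `C^∞` `(n+1)`-manifold with boundary and `i : ℝⁿ⁺¹ → W'` a smooth open
embedding into the interior (`Literature.Topology.FourManifolds.BallRemovalData`; such discs exist at every interior point,
`Literature.Topology.FourManifolds.exists_isSmoothEmbedding_of_isInteriorPoint`, and a null-cobordism of a nonempty manifold has
interior points, `Literature.Topology.FourManifolds.NullCobordism.exists_isInteriorPoint`). The complement `W' ∖ i(B)` of the
open unit ball is assembled, as a `C^∞` manifold with boundary, by the tree's gluing of manifolds
with boundary (`GluingConstructionBoundary.lean`) from

* the open submanifold `A = W' ∖ i(B̄)` of `W'` (closed unit ball removed), and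
* the open submanifold `B = {b : ½ < ‖b‖}` of the closed unit ball `𝔻ⁿ⁺¹` (tree structure
  `ClosedBall.lean`), whose boundary is the unit sphere,

glued along the inversion `a = i(v) ↦ v/‖v‖²` of the shell `i({1 < ‖v‖ < 2}) ⊆ A` onto
`{½ < ‖b‖ < 1} ⊆ B`. The glued manifold `K` is compact Hausdorff, its boundary is
`∂W' ⊔ Sⁿ` (`BallRemovalData.boundary_K_eq`), and `a ↦ a`, `b ↦ i(b/‖b‖²)` induce a homeomorphism
`K ≅ W' ∖ i(B)` (`BallRemovalData.homeomorph`) which is the identity on `∂W'` and `i` on the unit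
sphere. For a null-cobordism `M = ∂W'` this gives the cobordism `(K; M, 𝕊ⁿ)`
(`BallRemovalData.cobordism`) and the statement of the named fact
(`NullCobordism.exists_cobordism_sphere_homeomorph_compl_ball`).

Also proved here (general differential topology, absent from Mathlib and the tree): the
inclusion of the interior `InteriorManifold I M → M` is a smooth embedding
(`InteriorManifold.isSmoothEmbedding_val`).

## References

* M. Kervaire, J. Milnor, *Groups of homotopy spheres I*, Ann. of Math. (2) 77 (1963), 504–537,
  proof of Lemma 2.3 (p. 506). doi:10.2307/1970128 [KervaireMilnorAnnals1963]
* J. Milnor, *Lectures on the h-cobordism theorem*, Princeton (1965), §1. [MilnorHCobordism1965]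
-/

open scoped Manifold ContDiff Topology
open Set Function Metric

noncomputable section

universe u

namespace Literature.Topology.FourManifolds

/-- Local notation: `𝔼 n` is the model Euclidean space `EuclideanSpace ℝ (Fin n)`. -/
local notation "𝔼 " n:arg => EuclideanSpace ℝ (Fin n)
/-- Local notation: `ℍ n` is the model half-space `EuclideanHalfSpace n`. -/
local notation "ℍ " n:arg => EuclideanHalfSpace n
/-- Local notation: `𝕊 n` is the unit sphere in `EuclideanSpace ℝ (Fin (n + 1))`. -/
local notation "𝕊 " n:arg => (Metric.sphere (0 : EuclideanSpace ℝ (Fin (n + 1))) 1)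
/-- Local notation: `𝔻 n` is the closed unit ball in `EuclideanSpace ℝ (Fin n)`. -/
local notation "𝔻 " n:arg => (Metric.closedBall (0 : EuclideanSpace ℝ (Fin n)) 1)

/-! ### The inclusion of the interior is a smooth embedding -/

namespace InteriorManifold

variable {E : Type*} [NormedAddCommGroup E] [NormedSpace ℝ E] {H : Type*} [TopologicalSpace H]
  {I : ModelWithCorners ℝ E H} {M : Type u} [TopologicalSpace M] [ChartedSpace H M]
  [IsManifold I ∞ M]

/-- The inclusion `val : InteriorManifold I M → M` is a `C^∞` immersion at every point (with
trivial complement): in the charts `interiorChart y` and `chartAt H y.val` it reads `u ↦ u`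
(Bröcker–Jänich (1982), (13.3)). [folklore] -/
theorem isImmersionAtOfComplement_val (y : InteriorManifold I M) :
    Manifold.IsImmersionAtOfComplement Unit 𝓘(ℝ, E) I ∞ (val : InteriorManifold I M → M) y := by
  refine Manifold.IsImmersionAtOfComplement.mk_of_continuousAt continuous_val.continuousAt
    (.prodUnique ℝ E _) (chartAt E y) (chartAt H y.val) (mem_chart_source E y)
    (mem_chart_source H y.val) (IsManifold.chart_mem_maximalAtlas y)
    (IsManifold.chart_mem_maximalAtlas y.val) ?_
  intro u hu
  have hu' : u ∈ (interiorChart y).target := by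
    simpa [OpenPartialHomeomorph.extend_target, chartAt_eq] using hu
  have h1 : ((chartAt E y).extend 𝓘(ℝ, E)).symm u = (interiorChart y).symm u := by
    simp [chartAt_eq]
  simp only [comp_apply, ContinuousLinearEquiv.prodUnique_apply]
  rw [h1, interiorChart_symm_apply_val y hu']
  exact ((chartAt H y.val).extend I).right_inv (interiorChart_target_subset y hu')

/-- **The inclusion of the interior is a smooth embedding** `InteriorManifold I M → M`
(models `𝓘(ℝ, E)`, `I`). Bröcker–Jänich, *Introduction to Differential Topology* (1982), (13.3).
[folklore] -/
theorem isSmoothEmbedding_val :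
    Manifold.IsSmoothEmbedding 𝓘(ℝ, E) I ∞ (val : InteriorManifold I M → M) :=
  ⟨Manifold.IsImmersionOfComplement.isImmersion fun y => isImmersionAtOfComplement_val y,
    isEmbedding_val⟩

end InteriorManifold

/-! ### Discs in the interior -/

section Disc

variable {n : ℕ} {W : Type u} [TopologicalSpace W] [ChartedSpace (ℍ (n + 1)) W]
  [IsManifold (𝓡∂ (n + 1)) ∞ W]

/-- **Every interior point of a manifold with boundary is the centre of a smooth open disc in
the interior**: a `C^∞` embedding `i : ℝⁿ⁺¹ → W` with open range contained in the interior and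
`i 0 = w` (the inverse of a chart of the interior onto `ℝⁿ⁺¹`,
`Literature.Topology.FourManifolds.exists_mem_maximalAtlas_target_eq_univ`, followed by the inclusion of the interior).
Kervaire–Milnor 1963, proof of Lemma 2.3: "an imbedded disk" in `Int W'`. [folklore] -/
theorem exists_isSmoothEmbedding_of_isInteriorPoint {w : W} (hw : (𝓡∂ (n + 1)).IsInteriorPoint w) :
    ∃ i : 𝔼 (n + 1) → W, Manifold.IsSmoothEmbedding 𝓘(ℝ, 𝔼 (n + 1)) (𝓡∂ (n + 1)) ∞ i ∧
      IsOpen (range i) ∧ range i ⊆ (𝓡∂ (n + 1)).interior W ∧ i 0 = w := by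
  set x : InteriorManifold (𝓡∂ (n + 1)) W := ⟨w, hw⟩
  obtain ⟨e, he, hxe, htgt, hex⟩ := exists_mem_maximalAtlas_target_eq_univ (E := 𝔼 (n + 1)) x
  have hsrc : e.symm.source = univ := by rw [e.symm_source, htgt]
  have hval := InteriorManifold.isSmoothEmbedding_val (I := 𝓡∂ (n + 1)) (M := W)
  have hi : Manifold.IsSmoothEmbedding 𝓘(ℝ, 𝔼 (n + 1)) (𝓡∂ (n + 1)) ∞
      (InteriorManifold.val ∘ e.symm) :=
    hval.comp_openPartialHomeomorph e.symm hsrc (contMDiffOn_symm_of_mem_maximalAtlas he)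
      (by rw [e.symm_symm, e.symm_target]; exact contMDiffOn_of_mem_maximalAtlas he)
  refine ⟨InteriorManifold.val ∘ e.symm, hi, ?_, ?_, ?_⟩
  · rw [e.symm.range_comp_eq_image_target hsrc, e.symm_target]
    exact InteriorManifold.isOpenMap_val _ e.open_source
  · rintro _ ⟨v, rfl⟩
    exact (e.symm v).property
  · show (e.symm 0).val = w
    rw [← hex, e.left_inv hxe]

end Disc

/-! ### Interior points of a null-cobordism -/

namespace NullCobordism

variable {n : ℕ} {M : Type u} [TopologicalSpace M] [ChartedSpace (𝔼 n) M]

/-- **A null-cobordism of a nonempty manifold has interior points**: push a boundary point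
`p = incl m` inwards in a boundary chart, along the inner normal `e₀` of the model half-space.
[folklore] -/
theorem exists_isInteriorPoint [Nonempty M] (c : NullCobordism n M) :
    ∃ w : c.W, (𝓡∂ (n + 1)).IsInteriorPoint w := by
  obtain ⟨m⟩ := ‹Nonempty M›
  set p : c.W := c.incl m
  set e := chartAt (ℍ (n + 1)) p with he
  set I := (𝓡∂ (n + 1)) with hI
  set z : ℍ (n + 1) := e p with hz
  set e₀ : 𝔼 (n + 1) := EuclideanSpace.single 0 1 with he₀
  set u : ℝ → 𝔼 (n + 1) := fun t => z.val + t • e₀ with hu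
  -- the pushed-in chart values `I.symm (u t)` stay in `e.target` for small `t`
  have hγ : Continuous fun t => I.symm (u t) :=
    I.continuous_symm.comp (continuous_const.add (continuous_id.smul continuous_const))
  have hγ0 : I.symm (u 0) = z := by
    have : u 0 = I z := by
      rw [hI, modelWithCornersEuclideanHalfSpace_apply]
      simp [hu]
    rw [this, I.left_inv]
  have hmem : ∀ᶠ t in 𝓝 (0 : ℝ), I.symm (u t) ∈ e.target := by
    refine hγ.continuousAt.preimage_mem_nhds ?_
    rw [hγ0]
    exact e.open_target.mem_nhds (e.map_source (mem_chart_source _ p))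
  obtain ⟨ε, hε, hball⟩ := Metric.mem_nhds_iff.1 hmem
  set t : ℝ := ε / 2 with ht
  have htpos : 0 < t := by positivity
  have htε : t ∈ Metric.ball (0 : ℝ) ε := by
    rw [Metric.mem_ball, dist_zero_right, Real.norm_eq_abs, abs_of_pos htpos]; linarith
  have h1 : I.symm (u t) ∈ e.target := hball htε
  have h2 : u t ∈ interior (range I) := by
    rw [hI, interior_range_modelWithCornersEuclideanHalfSpace]
    show 0 < (z.val + t • e₀) 0
    have hz0 : 0 ≤ z.val 0 := z.property
    simp [he₀]
    linarith
  exact ⟨(e.extend I).symm (u t),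
    InteriorManifold.isInteriorPoint_extend_symm (chart_mem_atlas _ p) ⟨h1, h2⟩⟩

/-- **An open disc in the interior of a null-cobordism** of a nonempty manifold (Kervaire–Milnor
1963, proof of Lemma 2.3: "an imbedded disk" in `W'`). [cite: KervaireMilnorAnnals1963, Lemma 2.3, proof (p. 506)] -/
theorem exists_isSmoothEmbedding_interior [Nonempty M] (c : NullCobordism n M) :
    ∃ i : 𝔼 (n + 1) → c.W, Manifold.IsSmoothEmbedding 𝓘(ℝ, 𝔼 (n + 1)) (𝓡∂ (n + 1)) ∞ i ∧
      IsOpen (range i) ∧ range i ⊆ (𝓡∂ (n + 1)).interior c.W := by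
  obtain ⟨w, hw⟩ := c.exists_isInteriorPoint
  obtain ⟨i, hi, ho, hr, -⟩ := exists_isSmoothEmbedding_of_isInteriorPoint hw
  exact ⟨i, hi, ho, hr⟩

end NullCobordism

/-! ### The inversion in the unit sphere -/

namespace BallRemoval

variable {k : ℕ}

/-- **The inversion in the unit sphere** `v ↦ v/‖v‖²` of `ℝᵏ ∖ {0}` (junk value `0` at `0`): an
involution exchanging `{1 < ‖v‖ < 2}` and `{½ < ‖v‖ < 1}` and fixing the unit sphere pointwise.
[folklore] -/
def sphInv (v : 𝔼 k) : 𝔼 k := (‖v‖ ^ 2)⁻¹ • v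

/-- `‖v/‖v‖²‖ = ‖v‖⁻¹`. [folklore] -/
theorem norm_sphInv (v : 𝔼 k) : ‖sphInv v‖ = ‖v‖⁻¹ := by
  by_cases hv : v = 0
  · simp [sphInv, hv]
  · have h : 0 < ‖v‖ := norm_pos_iff.2 hv
    rw [sphInv, norm_smul, norm_inv, Real.norm_eq_abs, abs_of_pos (by positivity)]
    field_simp

/-- The inversion of a nonzero vector is nonzero. [folklore] -/
theorem sphInv_ne_zero {v : 𝔼 k} (hv : v ≠ 0) : sphInv v ≠ 0 := by
  rw [← norm_pos_iff, norm_sphInv]; exact inv_pos.2 (norm_pos_iff.2 hv)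

/-- The inversion is an involution off the origin. [folklore] -/
theorem sphInv_sphInv {v : 𝔼 k} (hv : v ≠ 0) : sphInv (sphInv v) = v := by
  have h : 0 < ‖v‖ := norm_pos_iff.2 hv
  rw [sphInv, norm_sphInv, sphInv, smul_smul]
  have : (‖v‖⁻¹ ^ 2)⁻¹ * (‖v‖ ^ 2)⁻¹ = 1 := by field_simp
  rw [this, one_smul]

/-- The inversion fixes the unit sphere pointwise. [folklore] -/
theorem sphInv_of_norm_eq_one {v : 𝔼 k} (hv : ‖v‖ = 1) : sphInv v = v := by
  rw [sphInv, hv, one_pow, inv_one, one_smul]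

/-- The inversion is smooth off the origin. [folklore] -/
theorem contDiffOn_sphInv : ContDiffOn ℝ ∞ (sphInv : 𝔼 k → 𝔼 k) {v | v ≠ 0} := fun v hv =>
  (((contDiffAt_norm ℝ hv).pow 2).inv (by simpa using hv)).contDiffWithinAt.smul
    contDiffWithinAt_id

/-- The inversion is smooth at every nonzero vector. [folklore] -/
theorem contDiffAt_sphInv {v : 𝔼 k} (hv : v ≠ 0) : ContDiffAt ℝ ∞ (sphInv : 𝔼 k → 𝔼 k) v :=
  (contDiffOn_sphInv v hv).contDiffAt (isOpen_ne.mem_nhds hv)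

/-- The inversion is continuous off the origin. [folklore] -/
theorem continuousOn_sphInv : ContinuousOn (sphInv : 𝔼 k → 𝔼 k) {v | v ≠ 0} :=
  contDiffOn_sphInv.continuousOn

/-- The inversion maps the shell `1 < ‖v‖ < 2` into the shell `½ < ‖b‖ < 1`. [folklore] -/
theorem norm_sphInv_mem_of_mem {v : 𝔼 k} (hv : 1 < ‖v‖ ∧ ‖v‖ < 2) :
    2⁻¹ < ‖sphInv v‖ ∧ ‖sphInv v‖ < 1 := by
  rw [norm_sphInv]
  have h0 : 0 < ‖v‖ := by linarith
  constructor
  · rw [inv_lt_inv₀ (by norm_num) h0]; exact hv.2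
  · exact inv_lt_one_of_one_lt₀ hv.1

/-- The inversion maps the shell `½ < ‖b‖ < 1` into the shell `1 < ‖v‖ < 2`. [folklore] -/
theorem norm_sphInv_mem_of_mem' {b : 𝔼 k} (hb : 2⁻¹ < ‖b‖ ∧ ‖b‖ < 1) :
    1 < ‖sphInv b‖ ∧ ‖sphInv b‖ < 2 := by
  rw [norm_sphInv]
  have h0 : 0 < ‖b‖ := by linarith
  constructor
  · exact one_lt_inv₀ h0 |>.2 hb.2
  · have := (inv_lt_inv₀ h0 (by norm_num : (0 : ℝ) < 2⁻¹)).2 hb.1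
    simpa using this

/-! ### The shell and the second piece -/

/-- The open shell `{1 < ‖v‖ < 2}`. [folklore] -/
def shell (k : ℕ) : Set (𝔼 k) := {v | 1 < ‖v‖ ∧ ‖v‖ < 2}

/-- Membership in the shell. [folklore] -/
theorem mem_shell_iff {v : 𝔼 k} : v ∈ shell k ↔ 1 < ‖v‖ ∧ ‖v‖ < 2 := Iff.rfl

/-- The shell is open. [folklore] -/
theorem isOpen_shell : IsOpen (shell k) :=
  (isOpen_lt continuous_const continuous_norm).inter (isOpen_lt continuous_norm continuous_const)

/-- A vector of the shell is nonzero. [folklore] -/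
theorem ne_zero_of_mem_shell {v : 𝔼 k} (hv : v ∈ shell k) : v ≠ 0 := by
  rw [← norm_pos_iff]; exact lt_trans one_pos hv.1

variable (n : ℕ)

/-- **The second piece** `B = {b ∈ 𝔻ⁿ⁺¹ : ½ < ‖b‖}`, an open submanifold (with boundary the unit
sphere) of the closed unit ball. [folklore] -/
def B : TopologicalSpace.Opens (𝔻 (n + 1)) :=
  ⟨{b | 2⁻¹ < ‖(b : 𝔼 (n + 1))‖}, isOpen_lt continuous_const (continuous_norm.comp continuous_subtype_val)⟩

variable {n}

/-- Membership in the second piece. [folklore] -/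
theorem mem_B_iff {b : 𝔻 (n + 1)} : b ∈ B n ↔ 2⁻¹ < ‖(b : 𝔼 (n + 1))‖ := Iff.rfl

/-- The point of the second piece with underlying vector `v`, `½ < ‖v‖ ≤ 1`. [folklore] -/
def mkB (v : 𝔼 (n + 1)) (h1 : ‖v‖ ≤ 1) (h2 : 2⁻¹ < ‖v‖) : B n :=
  ⟨⟨v, mem_closedBall_zero_iff.2 h1⟩, h2⟩

/-- The underlying vector of `mkB v _ _` is `v`. [folklore] -/
@[simp] theorem coe_coe_mkB (v : 𝔼 (n + 1)) (h1 : ‖v‖ ≤ 1) (h2 : 2⁻¹ < ‖v‖) :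
    ((mkB v h1 h2 : 𝔻 (n + 1)) : 𝔼 (n + 1)) = v := rfl

/-- Points of the second piece have norm `≤ 1`. [folklore] -/
theorem B_norm_le_one (b : B n) : ‖((b : 𝔻 (n + 1)) : 𝔼 (n + 1))‖ ≤ 1 :=
  mem_closedBall_zero_iff.1 b.1.2

/-- Points of the second piece have norm `> ½`. [folklore] -/
theorem B_half_lt_norm (b : B n) : 2⁻¹ < ‖((b : 𝔻 (n + 1)) : 𝔼 (n + 1))‖ := b.2

/-- Points of the second piece are nonzero vectors. [folklore] -/
theorem B_ne_zero (b : B n) : ((b : 𝔻 (n + 1)) : 𝔼 (n + 1)) ≠ 0 := by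
  rw [← norm_pos_iff]; exact lt_trans (by norm_num) (B_half_lt_norm b)

/-- The base point `e₀` of the second piece (used as a junk value). [folklore] -/
def b₀ : B n := mkB (EuclideanSpace.single 0 1) (by simp) (by
  rw [PiLp.norm_single, norm_one]; norm_num)

/-- The target `{‖b‖ < 1} = {½ < ‖b‖ < 1}` of the gluing map in the second piece. [folklore] -/
def glueTarget : Set (B n) := {b | ‖((b : 𝔻 (n + 1)) : 𝔼 (n + 1))‖ < 1}

/-- Membership in the target of the gluing map. [folklore] -/
theorem mem_glueTarget_iff {b : B n} : b ∈ (glueTarget : Set (B n)) ↔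
    ‖((b : 𝔻 (n + 1)) : 𝔼 (n + 1))‖ < 1 := Iff.rfl

/-- The target of the gluing map is open. [folklore] -/
theorem isOpen_glueTarget : IsOpen (glueTarget : Set (B n)) :=
  isOpen_lt (continuous_norm.comp (continuous_subtype_val.comp continuous_subtype_val))
    continuous_const

/-- The vector underlying a point of `B` depends continuously on the point. [folklore] -/
theorem continuous_coe_coe_B : Continuous fun b : B n => ((b : 𝔻 (n + 1)) : 𝔼 (n + 1)) :=
  continuous_subtype_val.comp continuous_subtype_val

end BallRemoval

/-! ### Ball-removal data: an open disc in the interior -/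

/-- **Ball-removal data** on a manifold with boundary `W`: a smooth open embedding
`i : ℝⁿ⁺¹ → W` with range in the interior ("an imbedded disk" of Kervaire–Milnor 1963, proof of
Lemma 2.3, p. 506; the unit ball `i(B)` is the ball to be removed). [cite: KervaireMilnorAnnals1963, Lemma 2.3, proof (p. 506)] -/
structure BallRemovalData (n : ℕ) (W : Type u) [TopologicalSpace W] [ChartedSpace (ℍ (n + 1)) W] where
  /-- the disc -/
  i : 𝔼 (n + 1) → W
  /-- the disc is a smooth embedding -/
  isSmoothEmbedding_i : Manifold.IsSmoothEmbedding 𝓘(ℝ, 𝔼 (n + 1)) (𝓡∂ (n + 1)) ∞ i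
  /-- the disc is open -/
  isOpen_range : IsOpen (range i)
  /-- the disc lies in the interior -/
  range_subset_interior : range i ⊆ (𝓡∂ (n + 1)).interior W

namespace NullCobordism

/-- A null-cobordism of a nonempty manifold carries ball-removal data
(`exists_isSmoothEmbedding_interior`). [cite: KervaireMilnorAnnals1963, Lemma 2.3, proof (p. 506)] -/
theorem nonempty_ballRemovalData {n : ℕ} {M : Type u} [TopologicalSpace M] [ChartedSpace (𝔼 n) M]
    [Nonempty M] (c : NullCobordism n M) : Nonempty (BallRemovalData n c.W) := by
  obtain ⟨i, hi, ho, hr⟩ := c.exists_isSmoothEmbedding_interior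
  exact ⟨⟨i, hi, ho, hr⟩⟩

end NullCobordism

namespace BallRemovalData

open BallRemoval

variable {n : ℕ} {W : Type u} [TopologicalSpace W] [ChartedSpace (ℍ (n + 1)) W]
  (D : BallRemovalData n W)

/-- The disc is injective. [folklore] -/
theorem injective_i : Injective D.i := D.isSmoothEmbedding_i.isEmbedding.injective

/-- The disc is continuous. [folklore] -/
theorem continuous_i : Continuous D.i := D.isSmoothEmbedding_i.isEmbedding.continuous

/-- The disc is an open embedding. [folklore] -/
theorem isOpenEmbedding_i : Topology.IsOpenEmbedding D.i :=
  ⟨D.isSmoothEmbedding_i.isEmbedding, D.isOpen_range⟩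

/-- The disc is smooth. [folklore] -/
theorem contMDiff_i : ContMDiff 𝓘(ℝ, 𝔼 (n + 1)) (𝓡∂ (n + 1)) ∞ D.i :=
  D.isSmoothEmbedding_i.contMDiff

/-- Points of the disc are interior points. [folklore] -/
theorem isInteriorPoint_i (v : 𝔼 (n + 1)) : (𝓡∂ (n + 1)).IsInteriorPoint (D.i v) :=
  D.range_subset_interior (mem_range_self v)

/-- Points of the disc are not boundary points. [folklore] -/
theorem not_isBoundaryPoint_i (v : 𝔼 (n + 1)) : ¬ (𝓡∂ (n + 1)).IsBoundaryPoint (D.i v) :=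
  ((𝓡∂ (n + 1)).isInteriorPoint_iff_not_isBoundaryPoint (D.i v)).1 (D.isInteriorPoint_i v)

/-- The disc as an open partial homeomorphism `ℝⁿ⁺¹ ≅ range i`. [folklore] -/
def iPH : OpenPartialHomeomorph (𝔼 (n + 1)) W := D.isOpenEmbedding_i.toOpenPartialHomeomorph D.i

/-- `iPH` is `i` as a function. [folklore] -/
@[simp] theorem iPH_apply (v : 𝔼 (n + 1)) : D.iPH v = D.i v := rfl

/-- The source of `iPH` is everything. [folklore] -/
@[simp] theorem iPH_source : D.iPH.source = univ :=
  D.isOpenEmbedding_i.toOpenPartialHomeomorph_source D.i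

/-- The target of `iPH` is the range of the disc. [folklore] -/
@[simp] theorem iPH_target : D.iPH.target = range D.i :=
  D.isOpenEmbedding_i.toOpenPartialHomeomorph_target D.i

/-- **The inverse of the disc** `j : W → ℝⁿ⁺¹` (junk values off the range). [folklore] -/
def j : W → 𝔼 (n + 1) := D.iPH.symm

/-- `j ∘ i = id`. [folklore] -/
@[simp] theorem j_i (v : 𝔼 (n + 1)) : D.j (D.i v) = v :=
  D.isOpenEmbedding_i.toOpenPartialHomeomorph_left_inv

/-- `i ∘ j = id` on the range of the disc. [folklore] -/
theorem i_j {w : W} (hw : w ∈ range D.i) : D.i (D.j w) = w :=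
  Topology.IsOpenEmbedding.toOpenPartialHomeomorph_right_inv (f := D.i) D.isOpenEmbedding_i hw

/-- Membership in an image of the disc, through the inverse. [folklore] -/
theorem mem_image_i_iff {w : W} {s : Set (𝔼 (n + 1))} :
    w ∈ D.i '' s ↔ w ∈ range D.i ∧ D.j w ∈ s := by
  constructor
  · rintro ⟨v, hv, rfl⟩; exact ⟨mem_range_self v, by rwa [D.j_i]⟩
  · rintro ⟨hw, hs⟩; exact ⟨D.j w, hs, D.i_j hw⟩

/-- The inverse of the disc is continuous on the range. [folklore] -/
theorem continuousOn_j : ContinuousOn D.j (range D.i) := by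
  rw [← D.iPH_target]; exact D.iPH.continuousOn_symm

/-- The inverse of the disc is smooth on the range
(`Literature.Topology.FourManifolds.contMDiffOn_symm_of_isSmoothEmbedding`). [folklore] -/
theorem contMDiffOn_j [IsManifold (𝓡∂ (n + 1)) ∞ W] :
    ContMDiffOn (𝓡∂ (n + 1)) 𝓘(ℝ, 𝔼 (n + 1)) ∞ D.j (range D.i) :=
  contMDiffOn_symm_of_isSmoothEmbedding D.isSmoothEmbedding_i D.isOpenEmbedding_i

variable [T2Space W]

/-- The image of a closed ball under the disc is closed (it is compact). [folklore] -/
theorem isClosed_image_closedBall (r : ℝ) : IsClosed (D.i '' closedBall (0 : 𝔼 (n + 1)) r) :=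
  ((isCompact_closedBall _ _).image D.continuous_i).isClosed

/-! ### The first piece -/

/-- **The first piece** `A = W ∖ i(B̄)`, the complement of the image of the closed unit ball, an
open submanifold with boundary `∂W` (Kervaire–Milnor 1963, proof of Lemma 2.3: `W` minus the
imbedded disk, here with its new boundary sphere removed as well). [cite: KervaireMilnorAnnals1963, Lemma 2.3, proof (p. 506)] -/
def A : TopologicalSpace.Opens W :=
  ⟨(D.i '' closedBall (0 : 𝔼 (n + 1)) 1)ᶜ, (D.isClosed_image_closedBall 1).isOpen_compl⟩

/-- Membership in the first piece. [folklore] -/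
theorem mem_A_iff {w : W} : w ∈ D.A ↔ w ∉ D.i '' closedBall (0 : 𝔼 (n + 1)) 1 := Iff.rfl

/-- `i v ∈ A ↔ 1 < ‖v‖`. [folklore] -/
theorem i_mem_A_iff {v : 𝔼 (n + 1)} : D.i v ∈ D.A ↔ 1 < ‖v‖ := by
  rw [mem_A_iff, D.mem_image_i_iff, D.j_i, mem_closedBall_zero_iff, not_and, not_le]
  exact ⟨fun h => h (mem_range_self v), fun h _ => h⟩

/-- Points off the disc lie in the first piece. [folklore] -/
theorem mem_A_of_not_mem_range {w : W} (hw : w ∉ range D.i) : w ∈ D.A := fun h =>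
  hw ((D.mem_image_i_iff.1 h).1)

/-- A point of the range of the disc lies in `A` iff its coordinate has norm `> 1`. [folklore] -/
theorem mem_A_iff_of_mem_range {w : W} (hw : w ∈ range D.i) : w ∈ D.A ↔ 1 < ‖D.j w‖ := by
  obtain ⟨v, rfl⟩ := hw
  rw [D.i_mem_A_iff, D.j_i]

/-- The point `i (3e₀)` of the first piece (`‖3e₀‖ = 3 > 1`), used as a junk value. [folklore] -/
def a₀ : D.A :=
  ⟨D.i ((3 : ℝ) • EuclideanSpace.single 0 1), D.i_mem_A_iff.2 (by
    rw [norm_smul, PiLp.norm_single, norm_one, mul_one, Real.norm_eq_abs]; norm_num)⟩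

/-- The source `i({1 < ‖v‖ < 2}) ⊆ A` of the gluing map. [folklore] -/
def glueSource : Set D.A := {a | (a : W) ∈ D.i '' shell (n + 1)}

/-- Membership in the source of the gluing map: the point lies on the disc with coordinate in
the shell. [folklore] -/
theorem mem_glueSource_iff {a : D.A} :
    a ∈ D.glueSource ↔ (a : W) ∈ range D.i ∧ D.j (a : W) ∈ shell (n + 1) :=
  D.mem_image_i_iff

/-- The source of the gluing map is open. [folklore] -/
theorem isOpen_glueSource : IsOpen D.glueSource :=
  (D.isOpenEmbedding_i.isOpenMap _ isOpen_shell).preimage continuous_subtype_val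

/-! ### The gluing map and its inverse -/

/-- The bounds `½ < ‖j a/‖j a‖²‖ < 1` on the source of the gluing map. [folklore] -/
theorem norm_sphInv_j_mem {a : D.A} (ha : a ∈ D.glueSource) :
    2⁻¹ < ‖sphInv (D.j (a : W))‖ ∧ ‖sphInv (D.j (a : W))‖ < 1 :=
  norm_sphInv_mem_of_mem (D.mem_glueSource_iff.1 ha).2

attribute [local instance] Classical.propDecidable in
/-- **The gluing map** `a = i(v) ↦ v/‖v‖²` from the shell of the first piece to the second piece
(junk value `b₀` off the source). [folklore] -/
def glueFun (a : D.A) : B n :=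
  if ha : a ∈ D.glueSource then
    mkB (sphInv (D.j (a : W))) (D.norm_sphInv_j_mem ha).2.le (D.norm_sphInv_j_mem ha).1
  else b₀

/-- The vector underlying the gluing map on its source. [folklore] -/
theorem coe_glueFun_of_mem {a : D.A} (ha : a ∈ D.glueSource) :
    ((D.glueFun a : 𝔻 (n + 1)) : 𝔼 (n + 1)) = sphInv (D.j (a : W)) := by
  rw [glueFun, dif_pos ha]; rfl

omit [T2Space W] in
/-- The point `i(b/‖b‖²) ∈ W` of the inverse gluing map. [folklore] -/
def glueInvPt (b : B n) : W := D.i (sphInv ((b : 𝔻 (n + 1)) : 𝔼 (n + 1)))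

/-- On the target, the point of the inverse gluing map lies in the first piece. [folklore] -/
theorem glueInvPt_mem_A {b : B n} (hb : b ∈ (glueTarget : Set (B n))) : D.glueInvPt b ∈ D.A := by
  rw [glueInvPt, D.i_mem_A_iff]
  exact (norm_sphInv_mem_of_mem' ⟨B_half_lt_norm b, hb⟩).1

omit [T2Space W] in
/-- The point of the inverse gluing map depends continuously on `b`. [folklore] -/
theorem continuous_glueInvPt : Continuous D.glueInvPt := by
  have hc : Continuous (sphInv ∘ fun b : B n => ((b : 𝔻 (n + 1)) : 𝔼 (n + 1))) :=
    continuousOn_sphInv.comp_continuous continuous_coe_coe_B fun b => B_ne_zero b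
  exact D.continuous_i.comp hc

attribute [local instance] Classical.propDecidable in
/-- **The inverse gluing map** `b ↦ i(b/‖b‖²)` (junk value `a₀` off the target). [folklore] -/
def glueInv (b : B n) : D.A :=
  if hb : b ∈ (glueTarget : Set (B n)) then ⟨D.glueInvPt b, D.glueInvPt_mem_A hb⟩ else D.a₀

/-- The point underlying the inverse gluing map on the target. [folklore] -/
theorem coe_glueInv_of_mem {b : B n} (hb : b ∈ (glueTarget : Set (B n))) :
    (D.glueInv b : W) = D.i (sphInv ((b : 𝔻 (n + 1)) : 𝔼 (n + 1))) := by
  rw [glueInv, dif_pos hb]; rfl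

/-- The gluing map sends its source into the target. [folklore] -/
theorem glueFun_mem_target {a : D.A} (ha : a ∈ D.glueSource) :
    D.glueFun a ∈ (glueTarget : Set (B n)) := by
  rw [mem_glueTarget_iff, D.coe_glueFun_of_mem ha]; exact (D.norm_sphInv_j_mem ha).2

/-- The inverse gluing map sends the target into the source. [folklore] -/
theorem glueInv_mem_source {b : B n} (hb : b ∈ (glueTarget : Set (B n))) :
    D.glueInv b ∈ D.glueSource := by
  rw [glueSource, mem_setOf_eq, D.coe_glueInv_of_mem hb]
  exact ⟨_, norm_sphInv_mem_of_mem' ⟨B_half_lt_norm b, hb⟩, rfl⟩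

/-- `glueInv ∘ glueFun = id` on the source. [folklore] -/
theorem glueInv_glueFun {a : D.A} (ha : a ∈ D.glueSource) : D.glueInv (D.glueFun a) = a := by
  have hb := D.glueFun_mem_target ha
  obtain ⟨hr, hs⟩ := D.mem_glueSource_iff.1 ha
  apply Subtype.ext
  rw [D.coe_glueInv_of_mem hb, D.coe_glueFun_of_mem ha, sphInv_sphInv (ne_zero_of_mem_shell hs),
    D.i_j hr]

/-- `glueFun ∘ glueInv = id` on the target. [folklore] -/
theorem glueFun_glueInv {b : B n} (hb : b ∈ (glueTarget : Set (B n))) : D.glueFun (D.glueInv b) = b := by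
  have ha := D.glueInv_mem_source hb
  apply Subtype.ext
  apply Subtype.ext
  rw [D.coe_glueFun_of_mem ha, D.coe_glueInv_of_mem hb, D.j_i, sphInv_sphInv (B_ne_zero b)]

/-- The coordinate `a ↦ j a` is continuous on the source of the gluing map. [folklore] -/
theorem continuousOn_j_coe : ContinuousOn (fun a : D.A => D.j (a : W)) D.glueSource :=
  D.continuousOn_j.comp continuous_subtype_val.continuousOn fun _ ha => (D.mem_glueSource_iff.1 ha).1

/-- The gluing map is continuous on its source. [folklore] -/
theorem continuousOn_glueFun : ContinuousOn D.glueFun D.glueSource := by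
  rw [Topology.IsInducing.subtypeVal.continuousOn_iff, Topology.IsInducing.subtypeVal.continuousOn_iff]
  have h : ContinuousOn (fun a : D.A => sphInv (D.j (a : W))) D.glueSource :=
    continuousOn_sphInv.comp D.continuousOn_j_coe fun _ ha =>
      ne_zero_of_mem_shell (D.mem_glueSource_iff.1 ha).2
  exact h.congr fun a ha => D.coe_glueFun_of_mem ha

/-- The inverse gluing map is continuous on the target. [folklore] -/
theorem continuousOn_glueInv : ContinuousOn D.glueInv (glueTarget : Set (B n)) := by
  rw [Topology.IsInducing.subtypeVal.continuousOn_iff]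
  have h : ContinuousOn (fun b : B n => D.i (sphInv ((b : 𝔻 (n + 1)) : 𝔼 (n + 1))))
      (glueTarget : Set (B n)) :=
    D.continuous_i.comp_continuousOn (continuousOn_sphInv.comp continuous_coe_coe_B.continuousOn
      fun b _ => B_ne_zero b)
  exact h.congr fun b hb => D.coe_glueInv_of_mem hb

/-- **The gluing map as an open partial homeomorphism** `A ⊇ i({1 < ‖v‖ < 2}) ≅ {½ < ‖b‖ < 1} ⊆ B`.
[folklore] -/
def glue : OpenPartialHomeomorph D.A (B n) where
  toFun := D.glueFun
  invFun := D.glueInv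
  source := D.glueSource
  target := glueTarget
  map_source' _ ha := D.glueFun_mem_target ha
  map_target' _ hb := D.glueInv_mem_source hb
  left_inv' _ ha := D.glueInv_glueFun ha
  right_inv' _ hb := D.glueFun_glueInv hb
  open_source := D.isOpen_glueSource
  open_target := isOpen_glueTarget
  continuousOn_toFun := D.continuousOn_glueFun
  continuousOn_invFun := D.continuousOn_glueInv

/-- The source of the gluing map (definitional). [folklore] -/
@[simp] theorem glue_source : D.glue.source = D.glueSource := rfl

/-- The target of the gluing map (definitional). [folklore] -/
@[simp] theorem glue_target : D.glue.target = glueTarget := rfl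

/-- The gluing map as a function (definitional). [folklore] -/
theorem glue_apply (a : D.A) : D.glue a = D.glueFun a := rfl

/-- The inverse gluing map as a function (definitional). [folklore] -/
theorem glue_symm_apply (b : B n) : D.glue.symm b = D.glueInv b := rfl

/-! #### Smoothness of the gluing map and of its inverse -/

variable [IsManifold (𝓡∂ (n + 1)) ∞ W]

/-- The vector-valued gluing map `a ↦ j a/‖j a‖²` is smooth on the source. [folklore] -/
theorem contMDiffOn_sphInv_j :
    ContMDiffOn (𝓡∂ (n + 1)) 𝓘(ℝ, 𝔼 (n + 1)) ∞ (fun a : D.A => sphInv (D.j (a : W))) D.glueSource := by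
  have h1 : ContMDiffOn (𝓡∂ (n + 1)) 𝓘(ℝ, 𝔼 (n + 1)) ∞ (fun a : D.A => D.j (a : W)) D.glueSource :=
    D.contMDiffOn_j.comp contMDiff_subtype_val.contMDiffOn fun _ ha => (D.mem_glueSource_iff.1 ha).1
  intro a ha
  have h := ContMDiffAt.comp_contMDiffWithinAt a
    (contDiffAt_sphInv (ne_zero_of_mem_shell (D.mem_glueSource_iff.1 ha).2)).contMDiffAt (h1 a ha)
  exact h

/-- **The gluing map is smooth** on its source: read in `ℝⁿ⁺¹` it is `a ↦ j a/‖j a‖²`, and maps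
into the closed ball are smooth when they are smooth into `ℝⁿ⁺¹`
(`ContMDiffAt.codRestrict_closedBall`). [folklore] -/
theorem contMDiffOn_glue : ContMDiffOn (𝓡∂ (n + 1)) (𝓡∂ (n + 1)) ∞ D.glue D.glue.source := by
  intro a ha
  rw [glue_source] at ha
  -- the `ℝⁿ⁺¹`-valued map underlying `glueFun`, globally with values in `𝔻ⁿ⁺¹`
  set G : D.A → 𝔼 (n + 1) := fun a => ((D.glueFun a : 𝔻 (n + 1)) : 𝔼 (n + 1)) with hG
  have hG𝔻 : ∀ a, G a ∈ 𝔻 (n + 1) := fun a => (D.glueFun a : 𝔻 (n + 1)).2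
  have hGat : ContMDiffAt (𝓡∂ (n + 1)) 𝓘(ℝ, 𝔼 (n + 1)) ∞ G a := by
    have h := (D.contMDiffOn_sphInv_j a ha).contMDiffAt (D.isOpen_glueSource.mem_nhds ha)
    refine h.congr_of_eventuallyEq (Filter.eventuallyEq_of_mem (D.isOpen_glueSource.mem_nhds ha) ?_)
    intro a' ha'
    exact D.coe_glueFun_of_mem ha'
  have h𝔻 : ContMDiffAt (𝓡∂ (n + 1)) (𝓡∂ (n + 1)) ∞ (Set.codRestrict G (𝔻 (n + 1)) hG𝔻) a :=
    hGat.codRestrict_closedBall hG𝔻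
  have heq : Subtype.val ∘ D.glueFun = Set.codRestrict G (𝔻 (n + 1)) hG𝔻 := by
    funext a'; exact Subtype.ext rfl
  have h : ContMDiffAt (𝓡∂ (n + 1)) (𝓡∂ (n + 1)) ∞ D.glueFun a := by
    rw [← ContMDiffAt.subtypeVal_comp_iff, heq]; exact h𝔻
  exact h.contMDiffWithinAt

omit [T2Space W] [IsManifold (𝓡∂ (n + 1)) ∞ W] in
/-- The point `b ↦ i(b/‖b‖²) ∈ W` of the inverse gluing map is smooth on the second piece (the
inclusion `𝔻ⁿ⁺¹ ↪ ℝⁿ⁺¹` is smooth, `Literature.Topology.FourManifolds.contMDiff_coe_closedBall`). [folklore] -/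
theorem contMDiff_glueInvPt : ContMDiff (𝓡∂ (n + 1)) (𝓡∂ (n + 1)) ∞ D.glueInvPt := by
  have h1 : ContMDiff (𝓡∂ (n + 1)) 𝓘(ℝ, 𝔼 (n + 1)) ∞
      (fun b : B n => ((b : 𝔻 (n + 1)) : 𝔼 (n + 1))) :=
    contMDiff_coe_closedBall.comp contMDiff_subtype_val
  intro b
  have h2 : ContMDiffAt (𝓡∂ (n + 1)) 𝓘(ℝ, 𝔼 (n + 1)) ∞
      (sphInv ∘ fun b : B n => ((b : 𝔻 (n + 1)) : 𝔼 (n + 1))) b :=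
    ContMDiffAt.comp b (contDiffAt_sphInv (B_ne_zero b)).contMDiffAt (h1 b)
  exact (D.contMDiff_i _).comp b h2

omit [IsManifold (𝓡∂ (n + 1)) ∞ W] in
/-- **The inverse gluing map is smooth** on the target. [folklore] -/
theorem contMDiffOn_glue_symm : ContMDiffOn (𝓡∂ (n + 1)) (𝓡∂ (n + 1)) ∞ D.glue.symm D.glue.target := by
  intro b hb
  rw [glue_target] at hb
  have h : ContMDiffAt (𝓡∂ (n + 1)) (𝓡∂ (n + 1)) ∞ (Subtype.val ∘ D.glueInv) b := by
    refine (D.contMDiff_glueInvPt b).congr_of_eventuallyEq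
      (Filter.eventuallyEq_of_mem (isOpen_glueTarget.mem_nhds hb) fun b' hb' => ?_)
    exact D.coe_glueInv_of_mem hb'
  rw [ContMDiffAt.subtypeVal_comp_iff] at h
  exact h.contMDiffWithinAt

/-! ### The gluing datum and the glued manifold -/

/-- **The gluing datum of the ball removal**: `A = W ∖ i(B̄)` and `B = {½ < ‖b‖} ⊆ 𝔻ⁿ⁺¹` glued
along the inversion of the shell. [cite: KervaireMilnorAnnals1963, Lemma 2.3, proof (p. 506)] -/
def glueData : SmoothGlueData (𝓡∂ (n + 1)) (𝓡∂ (n + 1)) D.A (B n) (𝔼 (n + 1)) :=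
  ⟨D.glue, D.contMDiffOn_glue, D.contMDiffOn_glue_symm, ContinuousLinearEquiv.refl ℝ _,
    ContinuousLinearEquiv.refl ℝ _⟩

/-- The gluing map of the gluing datum is `glue` (definitional). [folklore] -/
@[simp] theorem glueData_glue : D.glueData.glue = D.glue := rfl

/-- **The manifold `K = W ∖ i(B)` with the open unit ball removed**, as the glued `C^∞` manifold
with boundary `A ∪_glue B` (Kervaire–Milnor 1963, proof of Lemma 2.3: "removing the interior of
an imbedded disk we obtain a … manifold `W` with `bW = M + (-Sⁿ)`"). [cite: KervaireMilnorAnnals1963, Lemma 2.3, proof (p. 506)] -/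
abbrev K : Type u := D.glueData.Glued

/-! ### Separation, compactness, countability -/

omit [IsManifold (𝓡∂ (n + 1)) ∞ W] in
/-- The graph of the gluing map is the closed set `{(a, b) : a = i(b/‖b‖²)}` (for `a ∈ A` this
forces `‖b‖ < 1`). [folklore] -/
theorem graph_glue_eq :
    {p : D.A × B n | p.1 ∈ D.glue.source ∧ D.glue p.1 = p.2} =
      {p : D.A × B n | (p.1 : W) = D.glueInvPt p.2} := by
  ext ⟨a, b⟩
  simp only [mem_setOf_eq, glue_source, glue_apply]
  constructor
  · rintro ⟨ha, rfl⟩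
    obtain ⟨hr, hs⟩ := D.mem_glueSource_iff.1 ha
    rw [glueInvPt, D.coe_glueFun_of_mem ha, sphInv_sphInv (ne_zero_of_mem_shell hs), D.i_j hr]
  · intro hab
    have hA : D.glueInvPt b ∈ D.A := hab ▸ a.2
    rw [glueInvPt, D.i_mem_A_iff, norm_sphInv, one_lt_inv₀ (norm_pos_iff.2 (B_ne_zero b))] at hA
    have hb : b ∈ (glueTarget : Set (B n)) := hA
    have ha : a = D.glueInv b := Subtype.ext (by rw [hab, D.coe_glueInv_of_mem hb]; rfl)
    refine ⟨ha ▸ D.glueInv_mem_source hb, ?_⟩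
    rw [ha, D.glueFun_glueInv hb]

omit [IsManifold (𝓡∂ (n + 1)) ∞ W] in
/-- The graph of the gluing map is closed. [folklore] -/
theorem isClosed_graph_glue : IsClosed {p : D.A × B n | p.1 ∈ D.glue.source ∧ D.glue p.1 = p.2} := by
  rw [D.graph_glue_eq]
  have h1 : Continuous fun p : D.A × B n => (p.1 : W) := continuous_subtype_val.comp continuous_fst
  have h2 : Continuous fun p : D.A × B n => D.glueInvPt p.2 := D.continuous_glueInvPt.comp continuous_snd
  exact isClosed_eq h1 h2

/-- **`K` is Hausdorff.** [folklore] -/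
instance t2Space_K : T2Space D.K := D.glueData.t2Space_of_isClosed_graph D.isClosed_graph_glue

omit [IsManifold (𝓡∂ (n + 1)) ∞ W] in
/-- The compact piece `K_A = W ∖ i(B(0, 4/3))` of the first piece. [folklore] -/
def KA : Set D.A := {a | (a : W) ∉ D.i '' ball (0 : 𝔼 (n + 1)) (4 / 3)}

/-- The compact piece `K_B = {3/4 ≤ ‖b‖}` of the second piece. [folklore] -/
def _root_.Literature.Topology.FourManifolds.BallRemoval.KB : Set (B n) := {b | 3 / 4 ≤ ‖((b : 𝔻 (n + 1)) : 𝔼 (n + 1))‖}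

omit [IsManifold (𝓡∂ (n + 1)) ∞ W] in
/-- `K_A` is compact when `W` is. [folklore] -/
theorem isCompact_KA [CompactSpace W] : IsCompact D.KA := by
  have himg : (Subtype.val : D.A → W) '' D.KA = (D.i '' ball (0 : 𝔼 (n + 1)) (4 / 3))ᶜ := by
    ext w
    simp only [mem_image, mem_compl_iff, KA, mem_setOf_eq]
    constructor
    · rintro ⟨a, ha, rfl⟩; exact ha
    · intro hw
      have hwA : w ∈ D.A := fun h => hw (image_mono (closedBall_subset_ball (by norm_num)) h)
      exact ⟨⟨w, hwA⟩, hw, rfl⟩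
  rw [Topology.IsInducing.subtypeVal.isCompact_iff]
  convert (D.isOpenEmbedding_i.isOpenMap _ isOpen_ball).isClosed_compl.isCompact using 1
  exact himg

omit [T2Space W] [IsManifold (𝓡∂ (n + 1)) ∞ W] in
/-- `K_B` is compact. [folklore] -/
theorem _root_.Literature.Topology.FourManifolds.BallRemoval.isCompact_KB : IsCompact (KB : Set (B n)) := by
  have hind : Topology.IsInducing fun b : B n => ((b : 𝔻 (n + 1)) : 𝔼 (n + 1)) :=
    Topology.IsInducing.subtypeVal.comp Topology.IsInducing.subtypeVal
  have himg : (fun b : B n => ((b : 𝔻 (n + 1)) : 𝔼 (n + 1))) '' KB =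
      closedBall (0 : 𝔼 (n + 1)) 1 ∩ {v | 3 / 4 ≤ ‖v‖} := by
    ext v
    simp only [mem_image, mem_inter_iff, mem_closedBall_zero_iff, mem_setOf_eq, KB]
    constructor
    · rintro ⟨b, hb, rfl⟩; exact ⟨B_norm_le_one b, hb⟩
    · rintro ⟨h1, h2⟩; exact ⟨mkB v h1 (by linarith), h2, rfl⟩
  rw [hind.isCompact_iff, himg]
  exact (isCompact_closedBall _ _).inter_right (isClosed_le continuous_const continuous_norm)

/-- **`K` is compact** when `W` is: it is covered by the images of `K_A` and `K_B`. [folklore] -/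
instance compactSpace_K [CompactSpace W] : CompactSpace D.K := by
  refine D.glueData.compactSpace_of_forall_not_mem D.isCompact_KA isCompact_KB ?_ ?_
  · intro a ha
    simp only [KA, mem_setOf_eq, not_not, D.mem_image_i_iff, mem_ball_zero_iff] at ha
    obtain ⟨hr, hlt⟩ := ha
    have h1 : 1 < ‖D.j (a : W)‖ := (D.mem_A_iff_of_mem_range hr).1 a.2
    have has : a ∈ D.glueSource := D.mem_glueSource_iff.2 ⟨hr, h1, by linarith⟩
    refine ⟨has, ?_⟩
    show 3 / 4 ≤ ‖((D.glueFun a : 𝔻 (n + 1)) : 𝔼 (n + 1))‖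
    rw [D.coe_glueFun_of_mem has, norm_sphInv]
    rw [le_inv_comm₀ (by norm_num) (by linarith)]
    linarith
  · intro b hb
    simp only [KB, mem_setOf_eq, not_le] at hb
    have hbt : b ∈ (glueTarget : Set (B n)) := by
      rw [mem_glueTarget_iff]; linarith
    refine ⟨hbt, ?_⟩
    show (D.glueInv b : W) ∉ D.i '' ball (0 : 𝔼 (n + 1)) (4 / 3)
    rw [D.coe_glueInv_of_mem hbt, D.mem_image_i_iff, D.j_i, mem_ball_zero_iff, norm_sphInv, not_and,
      not_lt]
    intro _
    rw [le_inv_comm₀ (by norm_num) (norm_pos_iff.2 (B_ne_zero b))]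
    linarith

/-- `K` is second countable when `W` is compact. [folklore] -/
instance secondCountableTopology_K [CompactSpace W] : SecondCountableTopology D.K :=
  D.glueData.secondCountableTopologyH

/-! ### The boundary of `K` -/

omit [IsManifold (𝓡∂ (n + 1)) ∞ W] in
/-- A point of the first piece is a boundary point of `A` iff it is one of `W`. [folklore] -/
theorem isBoundaryPoint_A_iff (a : D.A) :
    (𝓡∂ (n + 1)).IsBoundaryPoint a ↔ (𝓡∂ (n + 1)).IsBoundaryPoint (a : W) :=
  (𝓡∂ (n + 1)).isBoundaryPoint_iff_isBoundaryPoint_val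

omit [T2Space W] [IsManifold (𝓡∂ (n + 1)) ∞ W] in
/-- A point of the second piece is a boundary point iff it lies on the unit sphere. [folklore] -/
theorem _root_.Literature.Topology.FourManifolds.BallRemoval.isBoundaryPoint_B_iff (b : B n) :
    (𝓡∂ (n + 1)).IsBoundaryPoint b ↔ ‖((b : 𝔻 (n + 1)) : 𝔼 (n + 1))‖ = 1 := by
  rw [(𝓡∂ (n + 1)).isBoundaryPoint_iff_isBoundaryPoint_val]
  have h := Set.ext_iff.1 (boundary_closedBall n) (b : 𝔻 (n + 1))
  exact h

/-- A point `inl a` of `K` is a boundary point iff `a` is a boundary point of `W`. [folklore] -/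
theorem isBoundaryPoint_inl_iff (a : D.A) :
    (𝓡∂ (n + 1)).IsBoundaryPoint (D.glueData.inl a) ↔ (𝓡∂ (n + 1)).IsBoundaryPoint (a : W) := by
  rw [D.glueData.isBoundaryPoint_inl_iff, D.isBoundaryPoint_A_iff]

/-- A point `inr b` of `K` is a boundary point iff `‖b‖ = 1`. [folklore] -/
theorem isBoundaryPoint_inr_iff (b : B n) :
    (𝓡∂ (n + 1)).IsBoundaryPoint (D.glueData.inr b) ↔ ‖((b : 𝔻 (n + 1)) : 𝔼 (n + 1))‖ = 1 := by
  rw [D.glueData.isBoundaryPoint_inr_iff, isBoundaryPoint_B_iff]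

/-- **The boundary of `K`** is `∂W ⊔ Sⁿ`: the image of the boundary of `W` (which lies in `A`)
and the image of the unit sphere of `B` ("`bW = M + (-Sⁿ)`", Kervaire–Milnor 1963, p. 506).
[cite: KervaireMilnorAnnals1963, Lemma 2.3, proof (p. 506)] -/
theorem boundary_K_eq : (𝓡∂ (n + 1)).boundary D.K =
    D.glueData.inl '' {a | (𝓡∂ (n + 1)).IsBoundaryPoint (a : W)} ∪
      D.glueData.inr '' {b | ‖((b : 𝔻 (n + 1)) : 𝔼 (n + 1))‖ = 1} := by
  have hA : (𝓡∂ (n + 1)).boundary D.A = {a : D.A | (𝓡∂ (n + 1)).IsBoundaryPoint (a : W)} :=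
    Set.ext fun a => D.isBoundaryPoint_A_iff a
  have hB : (𝓡∂ (n + 1)).boundary (B n) = {b : B n | ‖((b : 𝔻 (n + 1)) : 𝔼 (n + 1))‖ = 1} :=
    Set.ext fun b => isBoundaryPoint_B_iff b
  rw [D.glueData.boundary_glued_eq, hA, hB]

end BallRemovalData

/-! ### The cobordism `(K; M, 𝕊ⁿ)` obtained from a null-cobordism -/

namespace BallRemoval

variable {n : ℕ}

/-- The unit sphere inside the second piece `B = {½ < ‖b‖} ⊆ 𝔻ⁿ⁺¹`. [folklore] -/
def sphB (y : 𝕊 n) : B n :=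
  ⟨Set.inclusion sphere_subset_closedBall y, by
    show 2⁻¹ < ‖(y : 𝔼 (n + 1))‖
    rw [norm_eq_of_mem_sphere y]; norm_num⟩

/-- The vector underlying `sphB y` is `y`. [folklore] -/
@[simp] theorem coe_coe_sphB (y : 𝕊 n) : ((sphB y : 𝔻 (n + 1)) : 𝔼 (n + 1)) = y := rfl

/-- `sphB y` has norm `1`. [folklore] -/
theorem norm_sphB (y : 𝕊 n) : ‖((sphB y : 𝔻 (n + 1)) : 𝔼 (n + 1))‖ = 1 := by
  rw [coe_coe_sphB]; exact norm_eq_of_mem_sphere y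

/-- **The unit sphere is smoothly embedded in the second piece** (corestriction to the open
subset `B` of the tree theorem `isSmoothEmbedding_sphereInclusion'_holds`: `𝕊ⁿ ↪ 𝔻ⁿ⁺¹` is a
smooth embedding). [folklore] -/
theorem isSmoothEmbedding_sphB :
    Manifold.IsSmoothEmbedding (𝓡 n) (𝓡∂ (n + 1)) ∞ (sphB : (𝕊 n) → B n) :=
  (isSmoothEmbedding_sphereInclusion'_holds n).codRestrict_opens (B n) fun y => (sphB y).2

end BallRemoval

namespace BallRemovalData

open BallRemoval

variable {n : ℕ} {M : Type} [TopologicalSpace M] [ChartedSpace (𝔼 n) M]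
  (c : NullCobordism n M) (D : BallRemovalData n c.W)

/-- Boundary points of `W` lie in the first piece (the disc lies in the interior). [folklore] -/
theorem mem_A_of_isBoundaryPoint {w : c.W} (hw : (𝓡∂ (n + 1)).IsBoundaryPoint w) : w ∈ D.A :=
  D.mem_A_of_not_mem_range fun ⟨v, hv⟩ => D.not_isBoundaryPoint_i v (hv ▸ hw)

/-- The boundary inclusion of a null-cobordism consists of boundary points. [folklore] -/
theorem _root_.Literature.Topology.FourManifolds.NullCobordism.isBoundaryPoint_incl (x : M) :
    (𝓡∂ (n + 1)).IsBoundaryPoint (c.incl x) := by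
  have h : c.incl x ∈ (𝓡∂ (n + 1)).boundary c.W := c.range_incl ▸ mem_range_self x
  exact h

/-- The boundary inclusion lands in the first piece. [folklore] -/
theorem incl_mem_A (x : M) : c.incl x ∈ D.A := D.mem_A_of_isBoundaryPoint c (c.isBoundaryPoint_incl x)

/-- The boundary inclusion does not meet the disc. [folklore] -/
theorem incl_not_mem_range (x : M) : c.incl x ∉ range D.i := fun ⟨v, hv⟩ =>
  D.not_isBoundaryPoint_i v (hv ▸ c.isBoundaryPoint_incl x)

/-- The boundary inclusion `M → A`. [folklore] -/
def inclA (x : M) : D.A := ⟨c.incl x, D.incl_mem_A c x⟩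

/-- The underlying point of `inclA x` is `incl x`. [folklore] -/
@[simp] theorem coe_inclA (x : M) : (D.inclA c x : c.W) = c.incl x := rfl

/-- `inclA` is a smooth embedding (corestriction of the boundary embedding to the open subset
`A`, `Manifold.IsSmoothEmbedding.codRestrict_opens`). [folklore] -/
theorem isSmoothEmbedding_inclA [IsManifold (𝓡 n) ∞ M] :
    Manifold.IsSmoothEmbedding (𝓡 n) (𝓡∂ (n + 1)) ∞ (D.inclA c) :=
  c.isSmoothEmbedding_incl.codRestrict_opens D.A (D.incl_mem_A c)

/-- `inclA x` is not in the source of the gluing map (which lies on the disc). [folklore] -/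
theorem inclA_not_mem_glueSource (x : M) : D.inclA c x ∉ D.glueSource := fun h =>
  D.incl_not_mem_range c x (D.mem_glueSource_iff.1 h).1

/-- **The incoming end `M → K`** of the cobordism: `M = ∂W ⊆ A ⊆ K`. [cite: KervaireMilnorAnnals1963, Lemma 2.3, proof (p. 506)] -/
def cobInl (x : M) : D.K := D.glueData.inl (D.inclA c x)

/-- **The outgoing end `𝕊ⁿ → K`** of the cobordism: the unit sphere of `B ⊆ K`
("`bW = M + (-Sⁿ)`"). [cite: KervaireMilnorAnnals1963, Lemma 2.3, proof (p. 506)] -/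
def cobInr (y : 𝕊 n) : D.K := D.glueData.inr (sphB y)

/-- The incoming end is `inl ∘ inclA` (definitional). [folklore] -/
theorem cobInl_apply (x : M) : D.cobInl c x = D.glueData.inl (D.inclA c x) := rfl

/-- The outgoing end is `inr ∘ sphB` (definitional). [folklore] -/
theorem cobInr_apply (y : 𝕊 n) : D.cobInr c y = D.glueData.inr (sphB y) := rfl

/-- The incoming end is a smooth embedding. [folklore] -/
theorem isSmoothEmbedding_cobInl [IsManifold (𝓡 n) ∞ M] :
    Manifold.IsSmoothEmbedding (𝓡 n) (𝓡∂ (n + 1)) ∞ (D.cobInl c) :=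
  D.glueData.isSmoothEmbedding_inl_compH (D.isSmoothEmbedding_inclA c)

/-- The outgoing end is a smooth embedding. [folklore] -/
theorem isSmoothEmbedding_cobInr :
    Manifold.IsSmoothEmbedding (𝓡 n) (𝓡∂ (n + 1)) ∞ (D.cobInr c) :=
  D.glueData.isSmoothEmbedding_inr_compH isSmoothEmbedding_sphB

/-- The two ends are disjoint: `M` misses the disc, along which everything of `B` is glued.
[folklore] -/
theorem disjoint_range_cobInl_cobInr : Disjoint (range (D.cobInl c)) (range (D.cobInr c)) := by
  refine Set.disjoint_left.2 ?_
  rintro _ ⟨x, rfl⟩ ⟨y, hy⟩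
  rw [cobInr_apply, cobInl_apply, eq_comm, D.glueData.inl_eq_inr_iff] at hy
  exact D.inclA_not_mem_glueSource c x hy.1

/-- The range of the incoming end is the image of the boundary of `W`. [folklore] -/
theorem range_cobInl :
    range (D.cobInl c) = D.glueData.inl '' {a : D.A | (𝓡∂ (n + 1)).IsBoundaryPoint (a : c.W)} := by
  ext p
  constructor
  · rintro ⟨x, rfl⟩
    exact ⟨D.inclA c x, c.isBoundaryPoint_incl x, rfl⟩
  · rintro ⟨a, ha, rfl⟩
    have hr : (a : c.W) ∈ range c.incl := by
      rw [c.range_incl]; exact ha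
    obtain ⟨x, hx⟩ := hr
    refine ⟨x, ?_⟩
    rw [cobInl_apply]
    congr 1
    exact Subtype.ext hx

/-- The range of the outgoing end is the image of the unit sphere of `B`. [folklore] -/
theorem range_cobInr :
    range (D.cobInr c) = D.glueData.inr '' {b : B n | ‖((b : 𝔻 (n + 1)) : 𝔼 (n + 1))‖ = 1} := by
  ext p
  constructor
  · rintro ⟨y, rfl⟩
    exact ⟨sphB y, norm_sphB y, rfl⟩
  · rintro ⟨b, hb, rfl⟩
    refine ⟨⟨((b : 𝔻 (n + 1)) : 𝔼 (n + 1)), mem_sphere_zero_iff_norm.2 hb⟩, ?_⟩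
    rw [cobInr_apply]
    rfl

/-- **The ends cover the boundary of `K`**: `∂K = M ⊔ 𝕊ⁿ`. [cite: KervaireMilnorAnnals1963, Lemma 2.3, proof (p. 506)] -/
theorem range_cobInl_union_range_cobInr :
    range (D.cobInl c) ∪ range (D.cobInr c) = (𝓡∂ (n + 1)).boundary D.K := by
  rw [D.range_cobInl c, D.range_cobInr c, D.boundary_K_eq]

/-- **The cobordism `(K; M, 𝕊ⁿ)` obtained by removing the open unit ball `i(B)` from a
null-cobordism `M = ∂W`** (Kervaire–Milnor 1963, proof of Lemma 2.3, p. 506: "removing the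
interior of an imbedded disk we obtain a … manifold `W` with `bW = M + (-Sⁿ)`"; Milnor 1965, §1).
[cite: KervaireMilnorAnnals1963, Lemma 2.3, proof (p. 506)] -/
def cobordism [IsManifold (𝓡 n) ∞ M] : Cobordism n M (𝕊 n) where
  W := D.K
  inl := D.cobInl c
  inr := D.cobInr c
  isSmoothEmbedding_inl := D.isSmoothEmbedding_cobInl c
  isSmoothEmbedding_inr := D.isSmoothEmbedding_cobInr c
  disjoint_range := D.disjoint_range_cobInl_cobInr c
  range_inl_union_range_inr := D.range_cobInl_union_range_cobInr c

/-- The total space of the ball-removal cobordism is `K` (definitional). [folklore] -/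
theorem cobordism_W [IsManifold (𝓡 n) ∞ M] : (D.cobordism c).W = D.K := rfl

/-! ### The identification `K ≅ W ∖ i(B)` -/

/-- The complement `W ∖ i(B)` of the image of the open unit ball, as a subtype. [folklore] -/
abbrev Compl : Type := {w : c.W // w ∉ D.i '' ball (0 : 𝔼 (n + 1)) 1}

/-- Points of the first piece lie in the complement of `i(B)`. [folklore] -/
theorem coe_A_not_mem_image_ball (a : D.A) : (a : c.W) ∉ D.i '' ball (0 : 𝔼 (n + 1)) 1 := fun h =>
  a.2 (image_mono ball_subset_closedBall h)

/-- Points `i(b/‖b‖²)`, `‖b‖ ≤ 1`, lie in the complement of `i(B)`. [folklore] -/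
theorem glueInvPt_not_mem_image_ball (b : B n) : D.glueInvPt b ∉ D.i '' ball (0 : 𝔼 (n + 1)) 1 := by
  rw [glueInvPt, D.mem_image_i_iff, D.j_i, mem_ball_zero_iff, norm_sphInv, not_and, not_lt]
  intro _
  exact (one_le_inv₀ (norm_pos_iff.2 (B_ne_zero b))).2 (B_norm_le_one b)

/-- **The identification map `K → W ∖ i(B)`**: the identity on `A` and `b ↦ i(b/‖b‖²)` on `B`.
[folklore] -/
def toCompl : D.K → D.Compl c :=
  D.glueData.lift (fun a => ⟨a, D.coe_A_not_mem_image_ball c a⟩)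
    (fun b => ⟨D.glueInvPt b, D.glueInvPt_not_mem_image_ball c b⟩) fun a ha => Subtype.ext (by
      obtain ⟨hr, hs⟩ := D.mem_glueSource_iff.1 ha
      show (a : c.W) = D.glueInvPt (D.glueFun a)
      rw [glueInvPt, D.coe_glueFun_of_mem ha, sphInv_sphInv (ne_zero_of_mem_shell hs), D.i_j hr])

/-- The identification map on the first piece. [folklore] -/
@[simp] theorem coe_toCompl_inl (a : D.A) : (D.toCompl c (D.glueData.inl a) : c.W) = a := rfl

/-- The identification map on the second piece. [folklore] -/
@[simp] theorem coe_toCompl_inr (b : B n) :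
    (D.toCompl c (D.glueData.inr b) : c.W) = D.glueInvPt b := rfl

/-- The identification map is continuous. [folklore] -/
theorem continuous_toCompl : Continuous (D.toCompl c) :=
  D.glueData.continuous_lift (continuous_subtype_val.subtype_mk _)
    (D.continuous_glueInvPt.subtype_mk _)

/-- The identification map is injective. [folklore] -/
theorem injective_toCompl : Injective (D.toCompl c) := by
  -- a point of `A` and a point of `B` with the same image are glued
  have key : ∀ (a : D.A) (b : B n), (a : c.W) = D.glueInvPt b → D.glueData.inl a = D.glueData.inr b := by
    intro a b h
    have hg : (a, b) ∈ {p : D.A × B n | p.1 ∈ D.glue.source ∧ D.glue p.1 = p.2} := by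
      rw [D.graph_glue_eq]; exact h
    have ha : a ∈ D.glue.source := hg.1
    have hab : D.glue a = b := hg.2
    rw [← hab]
    exact (D.glueData.inr_glue ha).symm
  intro p q hpq
  have hv := congrArg Subtype.val hpq
  obtain ⟨a, rfl⟩ | ⟨b, rfl⟩ := D.glueData.exists_inl_or_inr p <;>
    obtain ⟨a', rfl⟩ | ⟨b', rfl⟩ := D.glueData.exists_inl_or_inr q
  · rw [coe_toCompl_inl, coe_toCompl_inl] at hv
    rw [Subtype.ext hv]
  · rw [coe_toCompl_inl, coe_toCompl_inr] at hv
    exact key a b' hv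
  · rw [coe_toCompl_inr, coe_toCompl_inl] at hv
    exact (key a' b hv.symm).symm
  · rw [coe_toCompl_inr, coe_toCompl_inr, glueInvPt, glueInvPt] at hv
    have h := D.injective_i hv
    have h' : ((b : 𝔻 (n + 1)) : 𝔼 (n + 1)) = ((b' : 𝔻 (n + 1)) : 𝔼 (n + 1)) := by
      rw [← sphInv_sphInv (B_ne_zero b), h, sphInv_sphInv (B_ne_zero b')]
    rw [Subtype.ext (Subtype.ext h')]

/-- The identification map is surjective: a point of `W ∖ i(B)` off the disc or with coordinate
of norm `> 1` comes from `A`, a point `i(v)` with `‖v‖ = 1` from the unit sphere of `B`.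
[folklore] -/
theorem surjective_toCompl : Surjective (D.toCompl c) := by
  rintro ⟨w, hw⟩
  by_cases hr : w ∈ range D.i
  · by_cases h1 : 1 < ‖D.j w‖
    · exact ⟨D.glueData.inl ⟨w, (D.mem_A_iff_of_mem_range hr).2 h1⟩, rfl⟩
    · have hge : 1 ≤ ‖D.j w‖ := by
        by_contra h
        exact hw (D.mem_image_i_iff.2 ⟨hr, mem_ball_zero_iff.2 (not_le.1 h)⟩)
      have heq : ‖D.j w‖ = 1 := le_antisymm (not_lt.1 h1) hge
      refine ⟨D.glueData.inr (mkB (D.j w) heq.le (by rw [heq]; norm_num)), Subtype.ext ?_⟩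
      show D.glueInvPt _ = w
      rw [glueInvPt, coe_coe_mkB, sphInv_of_norm_eq_one heq, D.i_j hr]
  · exact ⟨D.glueData.inl ⟨w, D.mem_A_of_not_mem_range hr⟩, rfl⟩

/-- The identification map as a bijection. [folklore] -/
def toComplEquiv : D.K ≃ D.Compl c :=
  Equiv.ofBijective (D.toCompl c) ⟨D.injective_toCompl c, D.surjective_toCompl c⟩

/-- **`K ≅ W ∖ i(B)`**: the identification map is a homeomorphism (a continuous bijection from
the compact space `K` to the Hausdorff space `W ∖ i(B)`). [folklore] -/
def homeomorph : D.K ≃ₜ D.Compl c :=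
  Continuous.homeoOfEquivCompactToT2 (f := D.toComplEquiv c) (D.continuous_toCompl c)

/-- The homeomorphism is the identification map (definitional). [folklore] -/
@[simp] theorem homeomorph_apply (p : D.K) : D.homeomorph c p = D.toCompl c p := rfl

/-- On the incoming end the homeomorphism is the boundary inclusion of `W`. [folklore] -/
theorem coe_homeomorph_cobInl (x : M) : (D.homeomorph c (D.cobInl c x) : c.W) = c.incl x := rfl

/-- On the outgoing end the homeomorphism is the disc restricted to the unit sphere (the
inversion fixes the unit sphere). [folklore] -/
theorem coe_homeomorph_cobInr (y : 𝕊 n) : (D.homeomorph c (D.cobInr c y) : c.W) = D.i y := by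
  show D.glueInvPt (sphB y) = D.i y
  rw [glueInvPt, coe_coe_sphB, sphInv_of_norm_eq_one (norm_eq_of_mem_sphere y)]

end BallRemovalData

/-! ### The smooth half of Kervaire–Milnor's Lemma 2.3 -/

namespace NullCobordism

/-- **Removing an open ball from the interior of a bounding manifold gives a cobordism to the
sphere** (Kervaire–Milnor 1963, proof of Lemma 2.3, p. 506; Milnor 1965, §1), in the exact form of
the named fact `Literature.Topology.FourManifolds.NullCobordism.exists_cobordism_sphere_compl_ball`
(`HomotopySpheresInverse.lean`): for a null-cobordism `M = ∂W'` of a nonempty closed smooth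
`n`-manifold there are a smooth embedding `i : ℝⁿ⁺¹ → Int W'` and a cobordism `(W; M, 𝕊ⁿ)`
with a homeomorphism `W ≅ W' ∖ i(B)` which is the boundary inclusion on `M` and `i` on `𝕊ⁿ`.
[cite: KervaireMilnorAnnals1963, Lemma 2.3, proof (p. 506)] [cite: MilnorHCobordism1965, §1] -/
theorem exists_cobordism_sphere_homeomorph_compl_ball (n : ℕ) (M : Type) [TopologicalSpace M]
    [T2Space M] [SecondCountableTopology M] [ChartedSpace (𝔼 n) M] [IsManifold (𝓡 n) ∞ M]
    [CompactSpace M] [Nonempty M] (c : NullCobordism n M) :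
    ∃ (i : 𝔼 (n + 1) → c.W) (d : Cobordism n M (𝕊 n))
      (h : d.W ≃ₜ {w : c.W // w ∉ i '' Metric.ball (0 : 𝔼 (n + 1)) 1}),
      Manifold.IsSmoothEmbedding 𝓘(ℝ, 𝔼 (n + 1)) (𝓡∂ (n + 1)) ∞ i ∧
      range i ⊆ (𝓡∂ (n + 1)).interior c.W ∧
      (∀ x : M, (h (d.inl x) : c.W) = c.incl x) ∧ ∀ y : 𝕊 n, (h (d.inr y) : c.W) = i y := by
  obtain ⟨D⟩ := c.nonempty_ballRemovalData
  exact ⟨D.i, D.cobordism c, D.homeomorph c, D.isSmoothEmbedding_i, D.range_subset_interior,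
    D.coe_homeomorph_cobInl c, D.coe_homeomorph_cobInr c⟩

end NullCobordism

end Literature.Topology.FourManifolds
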